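import Mathlib
import Literature.Combinatorics.Additive.TripleProductProperty
import Literature.Computability.AlgebraicComplexity.GroupTheoreticMatMulThmBProofs

/-!
# The CKSU Prop. 5.2 pair in `Cyc_n³` is a MAXIMAL STPP family (no third triple of any shape, `n ≥ 3`)

Support file for route `MatrixMultiplication/GroupTheoreticSTPP` (target `CThesis`, stmt-MatrixMultiplication-0593),
cell `mm-stpp` (D-0046), CENSUS-PLAN §3 (U8-THM) / §7 S7: statement and hand proof by the planner seat
mm-stpp-plan (HOME/mm-stpp-plan/ResidualTestSketch.lean, `Prop52PairMaximal`; residual test U8), kernel proof here.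

Host `H = (ℤ/n)³`, `n ≥ 3`.  `P_c` = punctured coordinate axis `{v : v supported on c, v ≠ 0}`.  The two
triples `T₀ = (P₀, P₁, P₂)`, `T₁ = (P₁, P₂, P₀)` are Cohn–Kleinberg–Szegedy–Umans 2005, Prop. 5.2 (an STPP
pair; `2(n−1)^ω ≤ n³`).  **Theorem (`prop52_pair_maximal`, functions `Fin 3 → ZMod n`;
`prop52_pair_maximal_prod`, census convention `IsSTPP` on `ZMod n × ZMod n × ZMod n`):** no triple
`(A₂, B₂, C₂)` of non-empty sets makes `{T₀, T₁, (A₂,B₂,C₂)}` an STPP family.  Proof (planner's residual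
test): with `a ∈ A₂, b ∈ B₂, c ∈ C₂` the nine index patterns of CKSU Def. 5.1 (ii) with exactly one index
`2` confine `a − c` to `P₀`, `b − a` to `P₁`, `c − b` to `P₂` (generic extraction lemmas
`zero_or_zero_of_avoid₃` / `ne_zero_of_avoid₃`, which only use that every element of `ℤ/n`, `n ≥ 3`, is a
sum of two non-zero elements), and `(a − c) + (b − a) + (c − b) = 0` has first coordinate `≠ 0`.
Consequences recorded by the planner: the engines' DRAT negatives "no third `(n−1)³` triple next to the
Prop 5.2 pair in `ℤ₄³`, `ℤ₅³`" hold for all shapes and all `n ≥ 3`; with the frame classification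
(`FramePacking.card_le_two_of_frames`, primes `≥ 5`) an STPP family in `(ℤ/p)³` with `k ≥ 3` members contains
at most one frame triple.

Also here (used for the product-type corollary and by `…CThesisFramePackingTwo.lean`):
`addSimultaneousTPP_image` — STPP families are preserved by injective additive maps.

WHAT THIS IS NOT: a structural negative about ONE seed pair; it certifies no `ω` bound and excludes no tier.

## References
* H. Cohn, R. Kleinberg, B. Szegedy, C. Umans, FOCS 2005, Def. 5.1, Prop. 5.2.
-/

-- single-conjunct summit: the mandated namespace repeats `MatrixMultiplication`.
set_option linter.dupNamespace false

namespace Summit.MatrixMultiplication.MatrixMultiplication.Theorems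

namespace Prop52Maximal

open Finset Literature.Combinatorics.Additive Literature.Computability.AlgebraicComplexity

/-! ### Transport of STPP families under injective additive maps -/

section Transport

variable {G G' : Type} [AddCommGroup G] [AddCommGroup G'] [DecidableEq G'] {ι : Type}

/-- **STPP families are preserved by injective additive maps** (take images of all sets): the defining
relations pull back along `f`. [cite: CohnKleinbergSzegedyUmans2005, Def. 5.1] -/
theorem addSimultaneousTPP_image {A B C : ι → Finset G} (h : AddSimultaneousTPP A B C)
    (f : G →+ G') (hf : Function.Injective f) :
    AddSimultaneousTPP (fun i => (A i).image f) (fun i => (B i).image f) (fun i => (C i).image f) := by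
  refine ⟨fun i => ?_, fun i j k a ha a' ha' b hb b' hb' c hc c' hc' heq => ?_⟩
  · intro s hs s' hs' t ht t' ht' u hu u' hu' heq
    obtain ⟨s₀, hs₀, rfl⟩ := Finset.mem_image.1 hs
    obtain ⟨s₀', hs₀', rfl⟩ := Finset.mem_image.1 hs'
    obtain ⟨t₀, ht₀, rfl⟩ := Finset.mem_image.1 ht
    obtain ⟨t₀', ht₀', rfl⟩ := Finset.mem_image.1 ht'
    obtain ⟨u₀, hu₀, rfl⟩ := Finset.mem_image.1 hu
    obtain ⟨u₀', hu₀', rfl⟩ := Finset.mem_image.1 hu'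
    have h0 : f (s₀ + -s₀' + (t₀ + -t₀') + (u₀ + -u₀')) = f 0 := by
      rw [map_zero]; simpa only [map_add, map_neg] using heq
    obtain ⟨h1, h2, h3⟩ := h.1 i s₀ hs₀ s₀' hs₀' t₀ ht₀ t₀' ht₀' u₀ hu₀ u₀' hu₀' (hf h0)
    exact ⟨by rw [h1], by rw [h2], by rw [h3]⟩
  · obtain ⟨a₀, ha₀, rfl⟩ := Finset.mem_image.1 ha
    obtain ⟨a₀', ha₀', rfl⟩ := Finset.mem_image.1 ha'
    obtain ⟨b₀, hb₀, rfl⟩ := Finset.mem_image.1 hb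
    obtain ⟨b₀', hb₀', rfl⟩ := Finset.mem_image.1 hb'
    obtain ⟨c₀, hc₀, rfl⟩ := Finset.mem_image.1 hc
    obtain ⟨c₀', hc₀', rfl⟩ := Finset.mem_image.1 hc'
    have h0 : f (a₀ + -a₀' + b₀ + -b₀' + c₀ + -c₀') = f 0 := by
      rw [map_zero]; simpa only [map_add, map_neg] using heq
    exact h.2 i j k a₀ ha₀ a₀' ha₀' b₀ hb₀ b₀' hb₀' c₀ hc₀ c₀' hc₀' (hf h0)

end Transport

/-! ### Arithmetic in `ZMod n`, `n ≥ 3`: every element is a sum of two non-zero elements -/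

section Arith

variable {n : ℕ}

/-- `1 ≠ 0` and `2 ≠ 0` in `ZMod n` for `n ≥ 3`. [folklore] -/
theorem one_two_ne_zero (hn : 3 ≤ n) : (1 : ZMod n) ≠ 0 ∧ (2 : ZMod n) ≠ 0 := by
  constructor
  · intro h
    have h1 : ((1 : ℕ) : ZMod n) = 0 := by exact_mod_cast h
    rw [ZMod.natCast_eq_zero_iff] at h1
    have := Nat.le_of_dvd (by norm_num) h1
    omega
  · intro h
    have h2 : ((2 : ℕ) : ZMod n) = 0 := by exact_mod_cast h
    rw [ZMod.natCast_eq_zero_iff] at h2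
    have := Nat.le_of_dvd (by norm_num) h2
    omega

/-- For `n ≥ 3` every `t ∈ ZMod n` splits as `t = s + (t − s)` with `s ≠ 0` and `t − s ≠ 0`. [folklore] -/
theorem exists_ne_zero_sub_ne_zero (hn : 3 ≤ n) (t : ZMod n) : ∃ s : ZMod n, s ≠ 0 ∧ t - s ≠ 0 := by
  obtain ⟨h1, h2⟩ := one_two_ne_zero hn
  by_cases h : t - 1 = 0
  · refine ⟨2, h2, ?_⟩
    have ht : t = 1 := by rw [sub_eq_zero] at h; exact h
    rw [ht]; norm_num; exact h1
  · exact ⟨1, h1, h⟩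

end Arith

/-! ### Generic extraction lemmas over `(ℤ/n)³` -/

section Extract

variable {n : ℕ}

/-- **Two axes once, the third twice.**  If `w + x + y + r + r' ≠ 0` for all `x ∈ P_α`, `y ∈ P_β`,
`r, r' ∈ P_γ` (punctured axes, `{α,β,γ} = {0,1,2}`, `n ≥ 3`), then `w_α = 0` or `w_β = 0`. [folklore] -/
theorem zero_or_zero_of_avoid₃ (hn : 3 ≤ n) {α β γ : Fin 3} (hαβ : α ≠ β) (hαγ : α ≠ γ) (hβγ : β ≠ γ)
    (hcov : ∀ i : Fin 3, i = α ∨ i = β ∨ i = γ)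
    {P Q R : Finset (Fin 3 → ZMod n)}
    (hP : ∀ x, x ∈ P ↔ x α ≠ 0 ∧ ∀ j, j ≠ α → x j = 0)
    (hQ : ∀ x, x ∈ Q ↔ x β ≠ 0 ∧ ∀ j, j ≠ β → x j = 0)
    (hR : ∀ x, x ∈ R ↔ x γ ≠ 0 ∧ ∀ j, j ≠ γ → x j = 0)
    {w : Fin 3 → ZMod n}
    (havoid : ∀ x ∈ P, ∀ y ∈ Q, ∀ r ∈ R, ∀ r' ∈ R, w + x + y + r + r' ≠ 0) :
    w α = 0 ∨ w β = 0 := by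
  by_contra hne
  rw [not_or] at hne
  obtain ⟨hα, hβ⟩ := hne
  obtain ⟨s, hs0, hst⟩ := exists_ne_zero_sub_ne_zero hn (-(w γ))
  have hx : Pi.single α (-(w α)) ∈ P := by
    rw [hP]; exact ⟨by simp [hα], fun j hj => by simp [Pi.single_eq_of_ne hj]⟩
  have hy : Pi.single β (-(w β)) ∈ Q := by
    rw [hQ]; exact ⟨by simp [hβ], fun j hj => by simp [Pi.single_eq_of_ne hj]⟩
  have hr : Pi.single γ s ∈ R := by
    rw [hR]; exact ⟨by simp [hs0], fun j hj => by simp [Pi.single_eq_of_ne hj]⟩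
  have hr' : Pi.single γ (-(w γ) - s) ∈ R := by
    rw [hR]; exact ⟨by simp [hst], fun j hj => by simp [Pi.single_eq_of_ne hj]⟩
  refine havoid _ hx _ hy _ hr _ hr' ?_
  funext i
  simp only [Pi.add_apply, Pi.zero_apply]
  rcases hcov i with rfl | rfl | rfl
  · rw [Pi.single_eq_same, Pi.single_eq_of_ne hαβ, Pi.single_eq_of_ne hαγ, Pi.single_eq_of_ne hαγ]
    ring
  · rw [Pi.single_eq_same, Pi.single_eq_of_ne (Ne.symm hαβ), Pi.single_eq_of_ne hβγ,
      Pi.single_eq_of_ne hβγ]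
    ring
  · rw [Pi.single_eq_same, Pi.single_eq_same, Pi.single_eq_of_ne (Ne.symm hαγ),
      Pi.single_eq_of_ne (Ne.symm hβγ)]
    ring

/-- **Two axes twice each, the third absent.**  If `w + x + x' + y + y' ≠ 0` for all `x, x' ∈ P_α`,
`y, y' ∈ P_β` (`{α,β,γ} = {0,1,2}`, `n ≥ 3`), then `w_γ ≠ 0`. [folklore] -/
theorem ne_zero_of_avoid₃ (hn : 3 ≤ n) {α β γ : Fin 3} (hαβ : α ≠ β) (hαγ : α ≠ γ) (hβγ : β ≠ γ)
    (hcov : ∀ i : Fin 3, i = α ∨ i = β ∨ i = γ)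
    {P Q : Finset (Fin 3 → ZMod n)}
    (hP : ∀ x, x ∈ P ↔ x α ≠ 0 ∧ ∀ j, j ≠ α → x j = 0)
    (hQ : ∀ x, x ∈ Q ↔ x β ≠ 0 ∧ ∀ j, j ≠ β → x j = 0)
    {w : Fin 3 → ZMod n}
    (havoid : ∀ x ∈ P, ∀ x' ∈ P, ∀ y ∈ Q, ∀ y' ∈ Q, w + x + x' + y + y' ≠ 0) :
    w γ ≠ 0 := by
  intro hγ
  obtain ⟨s, hs0, hst⟩ := exists_ne_zero_sub_ne_zero hn (-(w α))
  obtain ⟨s', hs0', hst'⟩ := exists_ne_zero_sub_ne_zero hn (-(w β))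
  have hx : Pi.single α s ∈ P := by
    rw [hP]; exact ⟨by simp [hs0], fun j hj => by simp [Pi.single_eq_of_ne hj]⟩
  have hx' : Pi.single α (-(w α) - s) ∈ P := by
    rw [hP]; exact ⟨by simp [hst], fun j hj => by simp [Pi.single_eq_of_ne hj]⟩
  have hy : Pi.single β s' ∈ Q := by
    rw [hQ]; exact ⟨by simp [hs0'], fun j hj => by simp [Pi.single_eq_of_ne hj]⟩
  have hy' : Pi.single β (-(w β) - s') ∈ Q := by
    rw [hQ]; exact ⟨by simp [hst'], fun j hj => by simp [Pi.single_eq_of_ne hj]⟩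
  refine havoid _ hx _ hx' _ hy _ hy' ?_
  funext i
  simp only [Pi.add_apply, Pi.zero_apply]
  rcases hcov i with rfl | rfl | rfl
  · rw [Pi.single_eq_same, Pi.single_eq_same, Pi.single_eq_of_ne hαβ, Pi.single_eq_of_ne hαβ]
    ring
  · rw [Pi.single_eq_same, Pi.single_eq_same, Pi.single_eq_of_ne (Ne.symm hαβ),
      Pi.single_eq_of_ne (Ne.symm hαβ)]
    ring
  · rw [Pi.single_eq_of_ne (Ne.symm hαγ), Pi.single_eq_of_ne (Ne.symm hαγ),
      Pi.single_eq_of_ne (Ne.symm hβγ), Pi.single_eq_of_ne (Ne.symm hβγ), hγ]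
    ring

/-- A punctured axis is closed under negation. [folklore] -/
theorem neg_mem_axis {P : Finset (Fin 3 → ZMod n)} {α : Fin 3}
    (hP : ∀ x, x ∈ P ↔ x α ≠ 0 ∧ ∀ j, j ≠ α → x j = 0) {x : Fin 3 → ZMod n} (hx : x ∈ P) : -x ∈ P := by
  rw [hP] at hx ⊢
  exact ⟨by simpa using hx.1, fun j hj => by simp [hx.2 j hj]⟩

/-- Two sets with the same axis description have the same members. [folklore] -/
theorem mem_of_mem_axis {P Q : Finset (Fin 3 → ZMod n)} {α : Fin 3}
    (hP : ∀ x, x ∈ P ↔ x α ≠ 0 ∧ ∀ j, j ≠ α → x j = 0)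
    (hQ : ∀ x, x ∈ Q ↔ x α ≠ 0 ∧ ∀ j, j ≠ α → x j = 0) {x : Fin 3 → ZMod n} (hx : x ∈ P) : x ∈ Q :=
  (hQ x).2 ((hP x).1 hx)

/-- … and the negative of a member of one lies in the other. [folklore] -/
theorem neg_mem_of_mem_axis {P Q : Finset (Fin 3 → ZMod n)} {α : Fin 3}
    (hP : ∀ x, x ∈ P ↔ x α ≠ 0 ∧ ∀ j, j ≠ α → x j = 0)
    (hQ : ∀ x, x ∈ Q ↔ x α ≠ 0 ∧ ∀ j, j ≠ α → x j = 0) {x : Fin 3 → ZMod n} (hx : x ∈ P) : -x ∈ Q :=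
  neg_mem_axis hQ (mem_of_mem_axis hP hQ hx)

end Extract

/-! ### The maximality theorem -/

section Main

variable {n : ℕ} {A B C : Fin 3 → Finset (Fin 3 → ZMod n)}

/-- **The CKSU Prop. 5.2 pair admits no third triple** (`n ≥ 3`; host `Fin 3 → ZMod n`).  Indices: `0` =
`(P₀,P₁,P₂)`, `1` = `(P₁,P₂,P₀)`, `2` = an arbitrary triple `(A 2, B 2, C 2)`.  If the three together
satisfy the simultaneous triple product property (additive CKSU Def. 5.1), then one of `A 2, B 2, C 2` is
empty.  Nine index patterns of clause (ii) with exactly one index `2` put `a − c ∈ P₀`, `b − a ∈ P₁`,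
`c − b ∈ P₂` for `a ∈ A 2, b ∈ B 2, c ∈ C 2`, and the three differences sum to `0`.  (Statement and hand
proof: planner seat mm-stpp-plan, U8-THM.) [cite: CohnKleinbergSzegedyUmans2005, Def. 5.1 and Prop. 5.2] -/
theorem prop52_pair_maximal (hn : 3 ≤ n)
    (hA0 : ∀ x, x ∈ A 0 ↔ x 0 ≠ 0 ∧ ∀ j, j ≠ 0 → x j = 0)
    (hB0 : ∀ x, x ∈ B 0 ↔ x 1 ≠ 0 ∧ ∀ j, j ≠ 1 → x j = 0)
    (hC0 : ∀ x, x ∈ C 0 ↔ x 2 ≠ 0 ∧ ∀ j, j ≠ 2 → x j = 0)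
    (hA1 : ∀ x, x ∈ A 1 ↔ x 1 ≠ 0 ∧ ∀ j, j ≠ 1 → x j = 0)
    (hB1 : ∀ x, x ∈ B 1 ↔ x 2 ≠ 0 ∧ ∀ j, j ≠ 2 → x j = 0)
    (hC1 : ∀ x, x ∈ C 1 ↔ x 0 ≠ 0 ∧ ∀ j, j ≠ 0 → x j = 0)
    (hS : AddSimultaneousTPP A B C) :
    ¬ ((A 2).Nonempty ∧ (B 2).Nonempty ∧ (C 2).Nonempty) := by
  rintro ⟨⟨a, ha⟩, ⟨b, hb⟩, ⟨c, hc⟩⟩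
  have h20 : ¬ ((2 : Fin 3) = 0) := by decide
  have h21 : ¬ ((2 : Fin 3) = 1) := by decide
  have h02 : ¬ ((0 : Fin 3) = 2) := by decide
  have h12 : ¬ ((1 : Fin 3) = 2) := by decide
  -- (1) `e₁ = a − c ∈ P₀`
  have e1x : (a - c) 0 ≠ 0 := by
    -- pattern (2,1,0)
    refine ne_zero_of_avoid₃ hn (α := 1) (β := 2) (γ := 0) (by decide) (by decide) (by decide) (by decide)
      hA1 hB1 (w := a - c) fun x hx x' hx' y hy y' hy' heq => ?_
    have key := hS.2 2 1 0 a ha (-x) (neg_mem_axis hA1 hx) y hy (-x') (neg_mem_of_mem_axis hA1 hB0 hx')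
      y' (mem_of_mem_axis hB1 hC0 hy') c hc (by rw [← heq]; abel)
    exact h21 key.1
  have e1z : (a - c) 2 = 0 := by
    -- pattern (2,0,0)
    refine (zero_or_zero_of_avoid₃ hn (α := 0) (β := 2) (γ := 1) (by decide) (by decide) (by decide)
      (by decide) hA0 hC0 hB0 (w := a - c) fun x hx y hy r hr r' hr' heq => ?_).resolve_left e1x
    have key := hS.2 2 0 0 a ha (-x) (neg_mem_axis hA0 hx) r hr (-r') (neg_mem_axis hB0 hr') y hy c hc
      (by rw [← heq]; abel)
    exact h20 key.1
  have e1y : (a - c) 1 = 0 := by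
    -- pattern (2,1,1)
    refine (zero_or_zero_of_avoid₃ hn (α := 0) (β := 1) (γ := 2) (by decide) (by decide) (by decide)
      (by decide) hC1 hA1 hB1 (w := a - c) fun x hx y hy r hr r' hr' heq => ?_).resolve_left e1x
    have key := hS.2 2 1 1 a ha (-y) (neg_mem_axis hA1 hy) r hr (-r') (neg_mem_axis hB1 hr') x hx c hc
      (by rw [← heq]; abel)
    exact h21 key.1
  -- (2) `e₂ = b − a ∈ P₁`
  have e2y : (b - a) 1 ≠ 0 := by
    -- pattern (0,2,1)
    refine ne_zero_of_avoid₃ hn (α := 0) (β := 2) (γ := 1) (by decide) (by decide) (by decide) (by decide)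
      hA0 hC0 (w := b - a) fun x hx x' hx' y hy y' hy' heq => ?_
    have key := hS.2 0 2 1 x hx a ha b hb (-y') (neg_mem_of_mem_axis hC0 hB1 hy')
      x' (mem_of_mem_axis hA0 hC1 hx') (-y) (neg_mem_axis hC0 hy) (by rw [← heq]; abel)
    exact h02 key.1
  have e2x : (b - a) 0 = 0 := by
    -- pattern (0,2,0)
    refine (zero_or_zero_of_avoid₃ hn (α := 0) (β := 1) (γ := 2) (by decide) (by decide) (by decide)
      (by decide) hA0 hB0 hC0 (w := b - a) fun x hx y hy r hr r' hr' heq => ?_).resolve_right e2y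
    have key := hS.2 0 2 0 x hx a ha b hb (-y) (neg_mem_axis hB0 hy) r hr (-r') (neg_mem_axis hC0 hr')
      (by rw [← heq]; abel)
    exact h02 key.1
  have e2z : (b - a) 2 = 0 := by
    -- pattern (1,2,1)
    refine (zero_or_zero_of_avoid₃ hn (α := 1) (β := 2) (γ := 0) (by decide) (by decide) (by decide)
      (by decide) hA1 hB1 hC1 (w := b - a) fun x hx y hy r hr r' hr' heq => ?_).resolve_left e2y
    have key := hS.2 1 2 1 x hx a ha b hb (-y) (neg_mem_axis hB1 hy) r hr (-r') (neg_mem_axis hC1 hr')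
      (by rw [← heq]; abel)
    exact h12 key.1
  -- (3) `e₃ = c − b ∈ P₂`
  have e3z : (c - b) 2 ≠ 0 := by
    -- pattern (1,0,2)
    refine ne_zero_of_avoid₃ hn (α := 0) (β := 1) (γ := 2) (by decide) (by decide) (by decide) (by decide)
      hA0 hA1 (w := c - b) fun x hx x' hx' y hy y' hy' heq => ?_
    have key := hS.2 1 0 2 y hy (-x) (neg_mem_axis hA0 hx) y' (mem_of_mem_axis hA1 hB0 hy') b hb c hc
      (-x') (neg_mem_of_mem_axis hA0 hC1 hx') (by rw [← heq]; abel)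
    exact h02 key.2
  have e3y : (c - b) 1 = 0 := by
    -- pattern (0,0,2)
    refine (zero_or_zero_of_avoid₃ hn (α := 1) (β := 2) (γ := 0) (by decide) (by decide) (by decide)
      (by decide) hB0 hC0 hA0 (w := c - b) fun x hx y hy r hr r' hr' heq => ?_).resolve_right e3z
    have key := hS.2 0 0 2 r hr (-r') (neg_mem_axis hA0 hr') x hx b hb c hc (-y) (neg_mem_axis hC0 hy)
      (by rw [← heq]; abel)
    exact h02 key.2
  have e3x : (c - b) 0 = 0 := by
    -- pattern (1,1,2)
    refine (zero_or_zero_of_avoid₃ hn (α := 0) (β := 2) (γ := 1) (by decide) (by decide) (by decide)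
      (by decide) hC1 hB1 hA1 (w := c - b) fun x hx y hy r hr r' hr' heq => ?_).resolve_right e3z
    have key := hS.2 1 1 2 r hr (-r') (neg_mem_axis hA1 hr') y hy b hb c hc (-x) (neg_mem_axis hC1 hx)
      (by rw [← heq]; abel)
    exact h12 key.2
  -- (4) the three differences sum to zero, but the first coordinate is `(a - c) 0 ≠ 0`
  have hsum : (a - c) 0 + (b - a) 0 + (c - b) 0 = 0 := by
    simp only [Pi.sub_apply]; ring
  rw [e2x, e3x, add_zero, add_zero] at hsum
  exact e1x hsum

end Main

/-! ### Census convention: `IsSTPP` on `ZMod n × ZMod n × ZMod n` -/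

section Prod

variable {n : ℕ}

/-- **The CKSU Prop. 5.2 pair admits no third triple, census form** (planner's S7 `Prop52PairMaximal`
up to the spelling of the axis sets): on `H = ZMod n × ZMod n × ZMod n`, `n ≥ 3`, with `P₀ = {(x,0,0)}`,
`P₁ = {(0,y,0)}`, `P₂ = {(0,0,z)}` (non-zero entries; membership hypotheses, so any explicit encoding such
as `cyc5Axis` qualifies by `decide`), no triple `(A₃, B₃, C₃)` of non-empty sets makes
`![P₀, P₁, A₃], ![P₁, P₂, B₃], ![P₂, P₀, C₃]` an `IsSTPP` family.  Reduced to `prop52_pair_maximal` by the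
additive isomorphism `(x,y,z) ↦ ![x,y,z]` (`addSimultaneousTPP_image`) and `isSTPP_iff_addSimultaneousTPP`.
[cite: CohnKleinbergSzegedyUmans2005, Def. 5.1 and Prop. 5.2] -/
theorem prop52_pair_maximal_prod (hn : 3 ≤ n) {P₀ P₁ P₂ A₃ B₃ C₃ : Finset (ZMod n × ZMod n × ZMod n)}
    (hP₀ : ∀ v, v ∈ P₀ ↔ v.1 ≠ 0 ∧ v.2.1 = 0 ∧ v.2.2 = 0)
    (hP₁ : ∀ v, v ∈ P₁ ↔ v.2.1 ≠ 0 ∧ v.1 = 0 ∧ v.2.2 = 0)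
    (hP₂ : ∀ v, v ∈ P₂ ↔ v.2.2 ≠ 0 ∧ v.1 = 0 ∧ v.2.1 = 0)
    (hA : A₃.Nonempty) (hB : B₃.Nonempty) (hC : C₃.Nonempty) :
    ¬ IsSTPP ![P₀, P₁, A₃] ![P₁, P₂, B₃] ![P₂, P₀, C₃] := by
  intro hS
  rw [isSTPP_iff_addSimultaneousTPP] at hS
  -- the coordinate isomorphism
  let f : (ZMod n × ZMod n × ZMod n) →+ (Fin 3 → ZMod n) :=
    { toFun := fun v => ![v.1, v.2.1, v.2.2]
      map_zero' := by funext i; fin_cases i <;> rfl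
      map_add' := fun v w => by funext i; fin_cases i <;> rfl }
  have hf0 : ∀ v, f v 0 = v.1 := fun v => rfl
  have hf1 : ∀ v, f v 1 = v.2.1 := fun v => rfl
  have hf2 : ∀ v, f v 2 = v.2.2 := fun v => rfl
  have hf : Function.Injective f := by
    intro v w h
    have h0 := congr_fun h 0; have h1 := congr_fun h 1; have h2 := congr_fun h 2
    rw [hf0, hf0] at h0; rw [hf1, hf1] at h1; rw [hf2, hf2] at h2
    exact Prod.ext h0 (Prod.ext h1 h2)
  have hS' := addSimultaneousTPP_image hS f hf
  -- membership descriptions of the transported sets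
  have axis : ∀ (P : Finset (ZMod n × ZMod n × ZMod n)) (α : Fin 3),
      (∀ v, v ∈ P ↔ f v α ≠ 0 ∧ ∀ j, j ≠ α → f v j = 0) →
        ∀ x, x ∈ P.image f ↔ x α ≠ 0 ∧ ∀ j, j ≠ α → x j = 0 := by
    intro P α hP x
    constructor
    · intro hx
      obtain ⟨v, hv, rfl⟩ := Finset.mem_image.1 hx
      exact (hP v).1 hv
    · rintro ⟨hα, hj⟩
      refine Finset.mem_image.2 ⟨(x 0, x 1, x 2), (hP _).2 ⟨?_, fun j hjα => ?_⟩, ?_⟩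
      · have : f (x 0, x 1, x 2) = x := by funext i; fin_cases i <;> rfl
        rw [this]; exact hα
      · have : f (x 0, x 1, x 2) = x := by funext i; fin_cases i <;> rfl
        rw [this]; exact hj j hjα
      · funext i; fin_cases i <;> rfl
  have hP₀' : ∀ v, v ∈ P₀ ↔ f v 0 ≠ 0 ∧ ∀ j, j ≠ 0 → f v j = 0 := by
    intro v; rw [hP₀ v]
    constructor
    · rintro ⟨h0, h1, h2⟩; exact ⟨h0, fun j hj => by fin_cases j <;> simp_all⟩
    · rintro ⟨h0, hj⟩; exact ⟨h0, hj 1 (by decide), hj 2 (by decide)⟩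
  have hP₁' : ∀ v, v ∈ P₁ ↔ f v 1 ≠ 0 ∧ ∀ j, j ≠ 1 → f v j = 0 := by
    intro v; rw [hP₁ v]
    constructor
    · rintro ⟨h0, h1, h2⟩; exact ⟨h0, fun j hj => by fin_cases j <;> simp_all⟩
    · rintro ⟨h0, hj⟩; exact ⟨h0, hj 0 (by decide), hj 2 (by decide)⟩
  have hP₂' : ∀ v, v ∈ P₂ ↔ f v 2 ≠ 0 ∧ ∀ j, j ≠ 2 → f v j = 0 := by
    intro v; rw [hP₂ v]
    constructor
    · rintro ⟨h0, h1, h2⟩; exact ⟨h0, fun j hj => by fin_cases j <;> simp_all⟩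
    · rintro ⟨h0, hj⟩; exact ⟨h0, hj 0 (by decide), hj 1 (by decide)⟩
  refine prop52_pair_maximal (A := fun i => (![P₀, P₁, A₃] i).image f)
    (B := fun i => (![P₁, P₂, B₃] i).image f) (C := fun i => (![P₂, P₀, C₃] i).image f) hn
    (axis P₀ 0 hP₀') (axis P₁ 1 hP₁') (axis P₂ 2 hP₂') (axis P₁ 1 hP₁') (axis P₂ 2 hP₂') (axis P₀ 0 hP₀')
    hS' ⟨?_, ?_, ?_⟩
  · exact (hA.image f)
  · exact (hB.image f)
  · exact (hC.image f)

end Prod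

end Prop52Maximal

end Summit.MatrixMultiplication.MatrixMultiplication.Theorems
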